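import Literature.AnabelianGeometry.EtaleTheta.Discharge.Sec5Prop53ThetaOrbit
import Literature.AnabelianGeometry.EtaleTheta.FrobenioidThetaDivisorSupportOrders
import HarnessLib

/-!
# [EtTh] §5, Prop. 5.3 (i)/(vi) at the pair — LINK (c): the ZERO/POLE SPLIT of an equality of transported divisors
# (GAP-LEDGER G-w5d245-2, link (c); abc-iut-L2-lead ROWS R320)

Mochizuki, *The étale theta function and its Frobenioid-theoretic manifestations*, Publ. RIMS **45** (2009), §5:
Prop. 5.3 (i) p. 325 (PDF p. 99) («non-cuspidal and cuspidal elements»), Prop. 5.3 (vi) p. 326 (PDF p. 100) («the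
`Aut_C(A_⊚)`-orbit of the divisor of zeroes and poles `∈ Φ(A_⊚)^gp` of … `Θ̈`»), Prop. 1.4 (i) p. 247 (PDF p. 21)
(«the zeroes of `Θ̈` on `Ÿ` are precisely the cusps of `Ÿ` …; the divisor of poles of `Θ̈` on `Ÿ` is precisely the
divisor `D₁`» — supported on the irreducible components of the special fibre), and the use made of them in the proof
of Thm. 5.6, p. 329 (PDF p. 103): «since `Ψ` [essentially] preserves the divisor of zeroes and poles of `Θ̈` [cf.
Proposition 5.3, (vi)], it follows … that there exist isomorphisms `γ₁ : S₁ ⥲ T₁`, `γ₂ : S₂ ⥲ T₂`, `u ∈ O^×(T₂)` …»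
[cite: MochizukiEtTh2009, Prop 5.3 (i) p.325 (PDF p.99); Prop 5.3 (vi) p.326 (PDF p.100); Prop 1.4 (i) p.247 (PDF p.21); Thm 5.6 proof p.329 (PDF p.103)].

Cell abc-iut, layer L2, PROOF-ONLY (0 definitions, no named fact), seat abc-iut-w6-d043 (gen 3), GAP-LEDGER row
G-w5d245-2 (filed by abc-iut-w5-d245), LINK (c) of the four links (a)–(d) from the typed Prop. 5.3 to the binder `hdiv`
of abc-iut-L2-d4's `Sec5Thm57.rootTransport_of` («Prop. 5.3 (vi) read at the base pair»):

  «Prop. 5.3 (i) (cuspidal = zero part, non-cuspidal = pole part) to split the orbit statement on `div(Θ̈)` into the two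
  effective halves».

WHAT IS PROVED (pure divisor bookkeeping in `Φ(A_⊚)^gp`, over abc-iut-L2-t4's `DivisorPrimeData 𝔓`):

* ORDER-COORDINATE form (non-vacuous at PERFECT `Φ(A_⊚)`, the currency of record of abc-iut-f-128's
  `Sec5Prop53ThetaOrbitOrders.lean`): for order functions `ord_𝔭 : Φ(A_⊚)^gp → ℚ` that SEPARATE elements (`hsep`,
  [EtTh] Prop. 3.2 (i): the product-valued factorization is injective) and are ADDITIVE (`hadd`, [FrdI] Def. 2.4 (i)(c):
  the factorization is a homomorphism) —
  - `eq_and_eq_of_mul_eq_mul_of_orders`: if `Z·W′ = Z′·W` with `Z, Z′` CUSPIDALLY supported (order `0` at every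
    non-cuspidal prime) and `W, W′` NON-CUSPIDALLY supported (order `0` at every cuspidal prime), then `Z = Z′` and
    `W = W′`; `eq_and_eq_of_div_eq_div_of_orders`: the same for `Z·W⁻¹ = Z′·W′⁻¹` — an element of `Φ(A_⊚)^gp` has AT
    MOST ONE decomposition «cuspidal zero part / non-cuspidal pole part»;
  - `gpMap_eq_gpMap_split_of_orders`: if two monoid automorphisms `φ, ψ` of `Φ(A_⊚)` transport orders
    (`ord_𝔮(φ^gp x) = ord_{φ⁻¹𝔮}(x)`) and preserve cuspidality of primes (Prop. 5.3 (i), prime clause), and agree on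
    `Z·W⁻¹` (`Z` cuspidal, `W` non-cuspidal), then they agree on `Z` and on `W` SEPARATELY;
  - `psiPhi_eq_pullAut_split_of_orders`: the instance `φ = Ψ^Φ_{A_⊚}` (`psiPhi 𝔉 Ψ ι e`, cuspidality by
    `CuspPreserved 𝔓 Ψ ι e` = Prop. 5.3 (i) on primes) and `ψ =` the action of `g ∈ Aut_C(A_⊚)` (`pullAut g`): an
    orbit equation `(Ψ^Φ)^gp (Z·W⁻¹) = g·(Z·W⁻¹)` (the shape delivered by Prop. 5.3 (vi) once `div(Θ̈) = Z·W⁻¹` is split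
    into its zero part `Z` and pole part `W`, Prop. 1.4 (i)) splits into `(Ψ^Φ)^gp Z = g·Z` and `(Ψ^Φ)^gp W = g·W`.
* `DivisorSupportData'` form (abc-iut-L6-d1's repaired support vocabulary, monoid type `ℤ`): the same four statements
  with `ord := 𝔖.ord`, where separation (`eq_of_ord_eq'`), additivity (`ord_mul`) and transport (`ord_gpMap'`) are
  THEOREMS — `eq_and_eq_of_div_eq_div'`, `gpMap_eq_gpMap_split'`, `psiPhi_eq_pullAut_split'`.

NOT HERE (the other links of G-w5d245-2): (a) the [FrdI] Thm. 4.9 divisor clause for `Ψ` (`DivisorTransportStub`),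
(b) the `div(Θ̈) ↔ (s^⊓, s^⊔)` dictionary in `Φ^gp`-currency, (d) the lift of `g ∈ Aut_C(A_⊚)` to an automorphism of
`A_N`.  HONEST FRAMING: kernel-checked implications between typed statements about the §5 data; every hypothesis is
a binder; nothing here asserts a result of [EtTh] for an actual curve; typed ≠ discharged; no side is taken on
[IUTchIII] Cor. 3.12.
-/

namespace Literature.AnabelianGeometry.EtaleTheta

open CategoryTheory
open Literature.AlgebraicGeometry.Frobenioids

universe w v v' u u'

namespace FrobenioidThetaDivisors

namespace DivisorPrimeData

variable {C : Type u} [Category.{v} C] {D : Type u'} [Category.{v'} D] {𝔉 : ThetaFrobenioid.{w} C D}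
  (𝔓 : DivisorPrimeData 𝔉) (ord : Primes 𝔉.PhiAcirc → Algebra.GrothendieckGroup 𝔉.PhiAcirc → ℚ)

/-! ### Order-coordinate form -/

section Orders

/-- **Uniqueness of the zero/pole decomposition** (order-coordinate form).  If `Z·W′ = Z′·W` in `Φ(A_⊚)^gp` with
`Z, Z′` supported on the CUSPIDAL primes and `W, W′` supported on the NON-cuspidal primes (orders vanish off the
respective class; Prop. 5.3 (i): «non-cuspidal and cuspidal elements»), and the orders separate elements and are
additive, then `Z = Z′` and `W = W′`. [cite: MochizukiEtTh2009, Prop 5.3 (i) p.325 (PDF p.99)] -/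
theorem eq_and_eq_of_mul_eq_mul_of_orders (hsep : ∀ x y, (∀ 𝔭, ord 𝔭 x = ord 𝔭 y) → x = y)
    (hadd : ∀ 𝔭 x y, ord 𝔭 (x * y) = ord 𝔭 x + ord 𝔭 y)
    {Z Z' W W' : Algebra.GrothendieckGroup 𝔉.PhiAcirc}
    (hZ : ∀ 𝔫, ¬ 𝔓.IsCuspidal 𝔫 → ord 𝔫 Z = 0) (hZ' : ∀ 𝔫, ¬ 𝔓.IsCuspidal 𝔫 → ord 𝔫 Z' = 0)
    (hW : ∀ 𝔠, 𝔓.IsCuspidal 𝔠 → ord 𝔠 W = 0) (hW' : ∀ 𝔠, 𝔓.IsCuspidal 𝔠 → ord 𝔠 W' = 0)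
    (h : Z * W' = Z' * W) : Z = Z' ∧ W = W' := by
  have hord : ∀ 𝔭, ord 𝔭 Z + ord 𝔭 W' = ord 𝔭 Z' + ord 𝔭 W := fun 𝔭 => by
    rw [← hadd, ← hadd, h]
  have hZZ : Z = Z' := hsep Z Z' fun 𝔭 => by
    by_cases h𝔭 : 𝔓.IsCuspidal 𝔭
    · have := hord 𝔭
      rw [hW 𝔭 h𝔭, hW' 𝔭 h𝔭] at this
      simpa using this
    · rw [hZ 𝔭 h𝔭, hZ' 𝔭 h𝔭]
  refine ⟨hZZ, hsep W W' fun 𝔭 => ?_⟩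
  by_cases h𝔭 : 𝔓.IsCuspidal 𝔭
  · rw [hW 𝔭 h𝔭, hW' 𝔭 h𝔭]
  · have := hord 𝔭
    rw [hZ 𝔭 h𝔭, hZ' 𝔭 h𝔭] at this
    simpa using this.symm

/-- **Uniqueness of the zero/pole decomposition**, fraction form: `Z·W⁻¹ = Z′·W′⁻¹` with `Z, Z′` cuspidally and
`W, W′` non-cuspidally supported forces `Z = Z′` and `W = W′`. [cite: MochizukiEtTh2009, Prop 5.3 (i) p.325 (PDF p.99)] -/
theorem eq_and_eq_of_div_eq_div_of_orders (hsep : ∀ x y, (∀ 𝔭, ord 𝔭 x = ord 𝔭 y) → x = y)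
    (hadd : ∀ 𝔭 x y, ord 𝔭 (x * y) = ord 𝔭 x + ord 𝔭 y)
    {Z Z' W W' : Algebra.GrothendieckGroup 𝔉.PhiAcirc}
    (hZ : ∀ 𝔫, ¬ 𝔓.IsCuspidal 𝔫 → ord 𝔫 Z = 0) (hZ' : ∀ 𝔫, ¬ 𝔓.IsCuspidal 𝔫 → ord 𝔫 Z' = 0)
    (hW : ∀ 𝔠, 𝔓.IsCuspidal 𝔠 → ord 𝔠 W = 0) (hW' : ∀ 𝔠, 𝔓.IsCuspidal 𝔠 → ord 𝔠 W' = 0)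
    (h : Z * W⁻¹ = Z' * W'⁻¹) : Z = Z' ∧ W = W' :=
  𝔓.eq_and_eq_of_mul_eq_mul_of_orders ord hsep hadd hZ hZ' hW hW' (by
    rw [← div_eq_mul_inv, ← div_eq_mul_inv, div_eq_div_iff_mul_eq_mul] at h
    exact h)

/-- Transport of supports: if `φ` transports orders and preserves cuspidality of primes, then `φ^gp` maps cuspidally
supported elements to cuspidally supported elements … [cite: MochizukiEtTh2009, Prop 5.3 (i) p.325 (PDF p.99)] -/
theorem ord_gpMap_eq_zero_of_not_isCuspidal_of_orders (φ : 𝔉.PhiAcirc ≃* 𝔉.PhiAcirc)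
    (hφo : ∀ 𝔮 x, ord 𝔮 (ThetaFrobenioid.gpMap (φ : 𝔉.PhiAcirc →* 𝔉.PhiAcirc) x) = ord (Primes.congr φ.symm 𝔮) x)
    (hφc : ∀ 𝔭, 𝔓.IsCuspidal (Primes.congr φ 𝔭) ↔ 𝔓.IsCuspidal 𝔭)
    {Z : Algebra.GrothendieckGroup 𝔉.PhiAcirc} (hZ : ∀ 𝔫, ¬ 𝔓.IsCuspidal 𝔫 → ord 𝔫 Z = 0)
    (𝔫 : Primes 𝔉.PhiAcirc) (h𝔫 : ¬ 𝔓.IsCuspidal 𝔫) :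
    ord 𝔫 (ThetaFrobenioid.gpMap (φ : 𝔉.PhiAcirc →* 𝔉.PhiAcirc) Z) = 0 := by
  rw [hφo]
  exact hZ _ ((𝔓.isCuspidal_congr_symm_iff φ hφc 𝔫).not.mpr h𝔫)

/-- … and non-cuspidally supported elements to non-cuspidally supported elements.
[cite: MochizukiEtTh2009, Prop 5.3 (i) p.325 (PDF p.99)] -/
theorem ord_gpMap_eq_zero_of_isCuspidal_of_orders (φ : 𝔉.PhiAcirc ≃* 𝔉.PhiAcirc)
    (hφo : ∀ 𝔮 x, ord 𝔮 (ThetaFrobenioid.gpMap (φ : 𝔉.PhiAcirc →* 𝔉.PhiAcirc) x) = ord (Primes.congr φ.symm 𝔮) x)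
    (hφc : ∀ 𝔭, 𝔓.IsCuspidal (Primes.congr φ 𝔭) ↔ 𝔓.IsCuspidal 𝔭)
    {W : Algebra.GrothendieckGroup 𝔉.PhiAcirc} (hW : ∀ 𝔠, 𝔓.IsCuspidal 𝔠 → ord 𝔠 W = 0)
    (𝔠 : Primes 𝔉.PhiAcirc) (h𝔠 : 𝔓.IsCuspidal 𝔠) :
    ord 𝔠 (ThetaFrobenioid.gpMap (φ : 𝔉.PhiAcirc →* 𝔉.PhiAcirc) W) = 0 := by
  rw [hφo]
  exact hW _ ((𝔓.isCuspidal_congr_symm_iff φ hφc 𝔠).mpr h𝔠)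

/-- **LINK (c), order-coordinate form: an equality of transported divisors SPLITS into its zero and pole halves.**
Let `φ, ψ` be monoid automorphisms of `Φ(A_⊚)` that transport orders and preserve cuspidality of primes (Prop. 5.3 (i),
prime clause), and let `Z` (cuspidally supported — the zero part) and `W` (non-cuspidally supported — the pole part)
satisfy `φ^gp (Z·W⁻¹) = ψ^gp (Z·W⁻¹)`.  Then `φ^gp Z = ψ^gp Z` and `φ^gp W = ψ^gp W`.
[cite: MochizukiEtTh2009, Prop 5.3 (i) p.325 (PDF p.99); Prop 5.3 (vi) p.326 (PDF p.100); Thm 5.6 proof p.329 (PDF p.103)] -/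
theorem gpMap_eq_gpMap_split_of_orders (hsep : ∀ x y, (∀ 𝔭, ord 𝔭 x = ord 𝔭 y) → x = y)
    (hadd : ∀ 𝔭 x y, ord 𝔭 (x * y) = ord 𝔭 x + ord 𝔭 y)
    (φ ψ : 𝔉.PhiAcirc ≃* 𝔉.PhiAcirc)
    (hφo : ∀ 𝔮 x, ord 𝔮 (ThetaFrobenioid.gpMap (φ : 𝔉.PhiAcirc →* 𝔉.PhiAcirc) x) = ord (Primes.congr φ.symm 𝔮) x)
    (hφc : ∀ 𝔭, 𝔓.IsCuspidal (Primes.congr φ 𝔭) ↔ 𝔓.IsCuspidal 𝔭)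
    (hψo : ∀ 𝔮 x, ord 𝔮 (ThetaFrobenioid.gpMap (ψ : 𝔉.PhiAcirc →* 𝔉.PhiAcirc) x) = ord (Primes.congr ψ.symm 𝔮) x)
    (hψc : ∀ 𝔭, 𝔓.IsCuspidal (Primes.congr ψ 𝔭) ↔ 𝔓.IsCuspidal 𝔭)
    {Z W : Algebra.GrothendieckGroup 𝔉.PhiAcirc}
    (hZ : ∀ 𝔫, ¬ 𝔓.IsCuspidal 𝔫 → ord 𝔫 Z = 0) (hW : ∀ 𝔠, 𝔓.IsCuspidal 𝔠 → ord 𝔠 W = 0)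
    (h : ThetaFrobenioid.gpMap (φ : 𝔉.PhiAcirc →* 𝔉.PhiAcirc) (Z * W⁻¹) =
      ThetaFrobenioid.gpMap (ψ : 𝔉.PhiAcirc →* 𝔉.PhiAcirc) (Z * W⁻¹)) :
    ThetaFrobenioid.gpMap (φ : 𝔉.PhiAcirc →* 𝔉.PhiAcirc) Z =
        ThetaFrobenioid.gpMap (ψ : 𝔉.PhiAcirc →* 𝔉.PhiAcirc) Z ∧
      ThetaFrobenioid.gpMap (φ : 𝔉.PhiAcirc →* 𝔉.PhiAcirc) W =
        ThetaFrobenioid.gpMap (ψ : 𝔉.PhiAcirc →* 𝔉.PhiAcirc) W := by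
  rw [map_mul, map_inv, map_mul, map_inv] at h
  exact 𝔓.eq_and_eq_of_div_eq_div_of_orders ord hsep hadd
    (𝔓.ord_gpMap_eq_zero_of_not_isCuspidal_of_orders ord φ hφo hφc hZ)
    (𝔓.ord_gpMap_eq_zero_of_not_isCuspidal_of_orders ord ψ hψo hψc hZ)
    (𝔓.ord_gpMap_eq_zero_of_isCuspidal_of_orders ord φ hφo hφc hW)
    (𝔓.ord_gpMap_eq_zero_of_isCuspidal_of_orders ord ψ hψo hψc hW) h

/-- **LINK (c) at `Ψ^Φ_{A_⊚}` versus `g ∈ Aut_C(A_⊚)`** (order-coordinate form).  With `φ := Ψ^Φ_{A_⊚} = psiPhi 𝔉 Ψ ι e`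
(cuspidality on primes = Prop. 5.3 (i), `CuspPreserved 𝔓 Ψ ι e`) and `ψ := pullAut g` (the `Aut_C(A_⊚)`-action of Prop.
5.3 (vi); its cuspidality/transport clauses are the `hAut` binders of record), an ORBIT EQUATION on a divisor written as
zero part over pole part, `(Ψ^Φ)^gp (Z·W⁻¹) = g·(Z·W⁻¹)` — the shape in which Prop. 5.3 (vi) is consumed by the proof of
Thm. 5.6 once `div(Θ̈)` is split by Prop. 1.4 (i) — yields `(Ψ^Φ)^gp Z = g·Z` AND `(Ψ^Φ)^gp W = g·W`.
[cite: MochizukiEtTh2009, Prop 5.3 (vi) p.326 (PDF p.100); Prop 1.4 (i) p.247 (PDF p.21); Thm 5.6 proof p.329 (PDF p.103)] -/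
theorem psiPhi_eq_pullAut_split_of_orders (hsep : ∀ x y, (∀ 𝔭, ord 𝔭 x = ord 𝔭 y) → x = y)
    (hadd : ∀ 𝔭 x y, ord 𝔭 (x * y) = ord 𝔭 x + ord 𝔭 y)
    (Ψ : C ≌ C) (ι : Ψ.functor.obj 𝔉.Acirc ≅ 𝔉.Acirc)
    (e : 𝔉.PhiAcirc ≃* 𝔉.pre.Mon (𝔉.base.obj (Ψ.functor.obj 𝔉.Acirc)))
    (hc : CuspPreserved 𝔓 Ψ ι e)
    (hψo : ∀ 𝔮 x, ord 𝔮 (ThetaFrobenioid.gpMap (psiPhi 𝔉 Ψ ι e : 𝔉.PhiAcirc →* 𝔉.PhiAcirc) x) =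
      ord (Primes.congr (psiPhi 𝔉 Ψ ι e).symm 𝔮) x)
    (g : Aut 𝔉.Acirc)
    (hgo : ∀ 𝔮 x, ord 𝔮 (ThetaFrobenioid.gpMap (𝔉.pullAut g : 𝔉.PhiAcirc →* 𝔉.PhiAcirc) x) =
      ord (Primes.congr (𝔉.pullAut g).symm 𝔮) x)
    (hgc : ∀ 𝔭, 𝔓.IsCuspidal (Primes.congr (𝔉.pullAut g) 𝔭) ↔ 𝔓.IsCuspidal 𝔭)
    {Z W : Algebra.GrothendieckGroup 𝔉.PhiAcirc}
    (hZ : ∀ 𝔫, ¬ 𝔓.IsCuspidal 𝔫 → ord 𝔫 Z = 0) (hW : ∀ 𝔠, 𝔓.IsCuspidal 𝔠 → ord 𝔠 W = 0)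
    (h : ThetaFrobenioid.gpMap (psiPhi 𝔉 Ψ ι e : 𝔉.PhiAcirc →* 𝔉.PhiAcirc) (Z * W⁻¹) =
      ThetaFrobenioid.gpMap (𝔉.pullAut g : 𝔉.PhiAcirc →* 𝔉.PhiAcirc) (Z * W⁻¹)) :
    ThetaFrobenioid.gpMap (psiPhi 𝔉 Ψ ι e : 𝔉.PhiAcirc →* 𝔉.PhiAcirc) Z =
        ThetaFrobenioid.gpMap (𝔉.pullAut g : 𝔉.PhiAcirc →* 𝔉.PhiAcirc) Z ∧
      ThetaFrobenioid.gpMap (psiPhi 𝔉 Ψ ι e : 𝔉.PhiAcirc →* 𝔉.PhiAcirc) W =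
        ThetaFrobenioid.gpMap (𝔉.pullAut g : 𝔉.PhiAcirc →* 𝔉.PhiAcirc) W :=
  𝔓.gpMap_eq_gpMap_split_of_orders ord hsep hadd (psiPhi 𝔉 Ψ ι e) (𝔉.pullAut g) hψo hc hgo hgc hZ hW h

end Orders

end DivisorPrimeData

/-! ### `DivisorSupportData'` form (monoid type `ℤ`: separation, additivity and transport are theorems) -/

namespace DivisorSupportData'

variable {C : Type u} [Category.{v} C] {D : Type u'} [Category.{v'} D] {𝔉 : ThetaFrobenioid.{w} C D}
  {𝔓 : DivisorPrimeData 𝔉} (𝔖 : DivisorSupportData' 𝔓)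

/-- The orders of abc-iut-L6-d1's repaired support data are transported by every monoid automorphism, in the shape of the
order-coordinate binders (`ord_gpMap'`). [cite: MochizukiEtTh2009, Prop 5.3 proof p.326 (PDF p.100)] -/
theorem ord_gpMap_coe (φ : 𝔉.PhiAcirc ≃* 𝔉.PhiAcirc) (𝔮 : Primes 𝔉.PhiAcirc)
    (x : Algebra.GrothendieckGroup 𝔉.PhiAcirc) :
    𝔖.ord 𝔮 (ThetaFrobenioid.gpMap (φ : 𝔉.PhiAcirc →* 𝔉.PhiAcirc) x) = 𝔖.ord (Primes.congr φ.symm 𝔮) x := by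
  rw [← MulEquiv.toMonoidHom_eq_coe]
  exact 𝔖.ord_gpMap' φ 𝔮 x

/-- **Uniqueness of the zero/pole decomposition** over `DivisorSupportData'`: `Z·W⁻¹ = Z′·W′⁻¹` with `Z, Z′` cuspidally and
`W, W′` non-cuspidally supported forces `Z = Z′`, `W = W′`. [cite: MochizukiEtTh2009, Prop 5.3 (i) p.325 (PDF p.99)] -/
theorem eq_and_eq_of_div_eq_div' {Z Z' W W' : Algebra.GrothendieckGroup 𝔉.PhiAcirc}
    (hZ : ∀ 𝔫, ¬ 𝔓.IsCuspidal 𝔫 → 𝔖.ord 𝔫 Z = 0) (hZ' : ∀ 𝔫, ¬ 𝔓.IsCuspidal 𝔫 → 𝔖.ord 𝔫 Z' = 0)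
    (hW : ∀ 𝔠, 𝔓.IsCuspidal 𝔠 → 𝔖.ord 𝔠 W = 0) (hW' : ∀ 𝔠, 𝔓.IsCuspidal 𝔠 → 𝔖.ord 𝔠 W' = 0)
    (h : Z * W⁻¹ = Z' * W'⁻¹) : Z = Z' ∧ W = W' :=
  𝔓.eq_and_eq_of_div_eq_div_of_orders 𝔖.ord (fun _ _ hxy => 𝔖.eq_of_ord_eq' hxy) 𝔖.ord_mul hZ hZ' hW hW' h

/-- **LINK (c) over `DivisorSupportData'`: an equality of transported divisors splits into its zero and pole halves** —
for cuspidality-preserving automorphisms `φ, ψ` of `Φ(A_⊚)` (orders are transported automatically, `ord_gpMap'`).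
[cite: MochizukiEtTh2009, Prop 5.3 (i) p.325 (PDF p.99); Prop 5.3 (vi) p.326 (PDF p.100); Thm 5.6 proof p.329 (PDF p.103)] -/
theorem gpMap_eq_gpMap_split' (φ ψ : 𝔉.PhiAcirc ≃* 𝔉.PhiAcirc)
    (hφc : ∀ 𝔭, 𝔓.IsCuspidal (Primes.congr φ 𝔭) ↔ 𝔓.IsCuspidal 𝔭)
    (hψc : ∀ 𝔭, 𝔓.IsCuspidal (Primes.congr ψ 𝔭) ↔ 𝔓.IsCuspidal 𝔭)
    {Z W : Algebra.GrothendieckGroup 𝔉.PhiAcirc}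
    (hZ : ∀ 𝔫, ¬ 𝔓.IsCuspidal 𝔫 → 𝔖.ord 𝔫 Z = 0) (hW : ∀ 𝔠, 𝔓.IsCuspidal 𝔠 → 𝔖.ord 𝔠 W = 0)
    (h : ThetaFrobenioid.gpMap (φ : 𝔉.PhiAcirc →* 𝔉.PhiAcirc) (Z * W⁻¹) =
      ThetaFrobenioid.gpMap (ψ : 𝔉.PhiAcirc →* 𝔉.PhiAcirc) (Z * W⁻¹)) :
    ThetaFrobenioid.gpMap (φ : 𝔉.PhiAcirc →* 𝔉.PhiAcirc) Z =
        ThetaFrobenioid.gpMap (ψ : 𝔉.PhiAcirc →* 𝔉.PhiAcirc) Z ∧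
      ThetaFrobenioid.gpMap (φ : 𝔉.PhiAcirc →* 𝔉.PhiAcirc) W =
        ThetaFrobenioid.gpMap (ψ : 𝔉.PhiAcirc →* 𝔉.PhiAcirc) W :=
  𝔓.gpMap_eq_gpMap_split_of_orders 𝔖.ord (fun _ _ hxy => 𝔖.eq_of_ord_eq' hxy) 𝔖.ord_mul φ ψ
    (𝔖.ord_gpMap_coe φ) hφc (𝔖.ord_gpMap_coe ψ) hψc hZ hW h

/-- **LINK (c) at `Ψ^Φ_{A_⊚}` versus `g ∈ Aut_C(A_⊚)`** over `DivisorSupportData'`: an orbit equation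
`(Ψ^Φ)^gp (Z·W⁻¹) = g·(Z·W⁻¹)` on a divisor written as (cuspidal) zero part over (non-cuspidal) pole part splits into
`(Ψ^Φ)^gp Z = g·Z` and `(Ψ^Φ)^gp W = g·W`, given Prop. 5.3 (i) on primes for `Ψ^Φ` (`CuspPreserved`) and cuspidality
preservation for `g`. [cite: MochizukiEtTh2009, Prop 5.3 (vi) p.326 (PDF p.100); Prop 1.4 (i) p.247 (PDF p.21); Thm 5.6 proof p.329 (PDF p.103)] -/
theorem psiPhi_eq_pullAut_split' (Ψ : C ≌ C) (ι : Ψ.functor.obj 𝔉.Acirc ≅ 𝔉.Acirc)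
    (e : 𝔉.PhiAcirc ≃* 𝔉.pre.Mon (𝔉.base.obj (Ψ.functor.obj 𝔉.Acirc)))
    (hc : CuspPreserved 𝔓 Ψ ι e) (g : Aut 𝔉.Acirc)
    (hgc : ∀ 𝔭, 𝔓.IsCuspidal (Primes.congr (𝔉.pullAut g) 𝔭) ↔ 𝔓.IsCuspidal 𝔭)
    {Z W : Algebra.GrothendieckGroup 𝔉.PhiAcirc}
    (hZ : ∀ 𝔫, ¬ 𝔓.IsCuspidal 𝔫 → 𝔖.ord 𝔫 Z = 0) (hW : ∀ 𝔠, 𝔓.IsCuspidal 𝔠 → 𝔖.ord 𝔠 W = 0)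
    (h : ThetaFrobenioid.gpMap (psiPhi 𝔉 Ψ ι e : 𝔉.PhiAcirc →* 𝔉.PhiAcirc) (Z * W⁻¹) =
      ThetaFrobenioid.gpMap (𝔉.pullAut g : 𝔉.PhiAcirc →* 𝔉.PhiAcirc) (Z * W⁻¹)) :
    ThetaFrobenioid.gpMap (psiPhi 𝔉 Ψ ι e : 𝔉.PhiAcirc →* 𝔉.PhiAcirc) Z =
        ThetaFrobenioid.gpMap (𝔉.pullAut g : 𝔉.PhiAcirc →* 𝔉.PhiAcirc) Z ∧
      ThetaFrobenioid.gpMap (psiPhi 𝔉 Ψ ι e : 𝔉.PhiAcirc →* 𝔉.PhiAcirc) W =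
        ThetaFrobenioid.gpMap (𝔉.pullAut g : 𝔉.PhiAcirc →* 𝔉.PhiAcirc) W :=
  𝔖.gpMap_eq_gpMap_split' (psiPhi 𝔉 Ψ ι e) (𝔉.pullAut g) hc hgc hZ hW h

/-- The same in abc-iut-L6-d1's SUPPORT vocabulary: `Z` a cuspidal element of `Φ(A_⊚)^gp` (`IsCuspidalGp`: support among
the cuspidal primes — the zero part, Prop. 1.4 (i) «the zeroes of `Θ̈` … are precisely the cusps») and `W` with support
among the NON-cuspidal primes (the pole part, «the divisor of poles … is precisely the divisor `D₁`»).
[cite: MochizukiEtTh2009, Prop 1.4 (i) p.247 (PDF p.21); Prop 5.3 (vi) p.326 (PDF p.100); Thm 5.6 proof p.329 (PDF p.103)] -/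
theorem psiPhi_eq_pullAut_split_of_supp' (Ψ : C ≌ C) (ι : Ψ.functor.obj 𝔉.Acirc ≅ 𝔉.Acirc)
    (e : 𝔉.PhiAcirc ≃* 𝔉.pre.Mon (𝔉.base.obj (Ψ.functor.obj 𝔉.Acirc)))
    (hc : CuspPreserved 𝔓 Ψ ι e) (g : Aut 𝔉.Acirc)
    (hgc : ∀ 𝔭, 𝔓.IsCuspidal (Primes.congr (𝔉.pullAut g) 𝔭) ↔ 𝔓.IsCuspidal 𝔭)
    {Z W : Algebra.GrothendieckGroup 𝔉.PhiAcirc}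
    (hZ : 𝔖.IsCuspidalGp Z) (hW : ∀ 𝔭 ∈ 𝔖.supp W, ¬ 𝔓.IsCuspidal 𝔭)
    (h : ThetaFrobenioid.gpMap (psiPhi 𝔉 Ψ ι e : 𝔉.PhiAcirc →* 𝔉.PhiAcirc) (Z * W⁻¹) =
      ThetaFrobenioid.gpMap (𝔉.pullAut g : 𝔉.PhiAcirc →* 𝔉.PhiAcirc) (Z * W⁻¹)) :
    ThetaFrobenioid.gpMap (psiPhi 𝔉 Ψ ι e : 𝔉.PhiAcirc →* 𝔉.PhiAcirc) Z =
        ThetaFrobenioid.gpMap (𝔉.pullAut g : 𝔉.PhiAcirc →* 𝔉.PhiAcirc) Z ∧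
      ThetaFrobenioid.gpMap (psiPhi 𝔉 Ψ ι e : 𝔉.PhiAcirc →* 𝔉.PhiAcirc) W =
        ThetaFrobenioid.gpMap (𝔉.pullAut g : 𝔉.PhiAcirc →* 𝔉.PhiAcirc) W :=
  𝔖.psiPhi_eq_pullAut_split' Ψ ι e hc g hgc (fun _ h𝔫 => 𝔖.ord_eq_zero_of_isCuspidalGp hZ h𝔫)
    (fun 𝔠 h𝔠 => 𝔖.ord_eq_zero_of_notMem_supp fun hmem => hW 𝔠 hmem h𝔠) h

end DivisorSupportData'

end FrobenioidThetaDivisors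

end Literature.AnabelianGeometry.EtaleTheta

/-! ### Generic form: any commutative group with separating additive order coordinates (e.g. `Φ(A_N)^gp` at the pair)

Appended for the assembler of G-w5d245-2 at the base pair (abc-iut-w5-d245 / abc-iut-L2-d4), whose currency is
`Φ(A_N)` rather than `Φ(A_⊚)`: the split uses nothing but a commutative group `G`, an index type `I` of «primes» with a
predicate `S` («cuspidal»), and order coordinates `ord : I → G → ℚ` that are additive and separate elements. -/

namespace Literature.AnabelianGeometry.EtaleTheta.FrobenioidThetaDivisors.ZeroPoleSplit

/-- **Uniqueness of the zero/pole decomposition, generic**: in a commutative group `G` with additive, separating order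
coordinates `ord : I → G → ℚ` and a class `S` of indices, `Z·W⁻¹ = Z′·W′⁻¹` with `Z, Z′` supported on `S` and `W, W′`
supported off `S` forces `Z = Z′` and `W = W′`. [cite: MochizukiEtTh2009, Prop 5.3 (i) p.325 (PDF p.99)] -/
theorem eq_and_eq_of_div_eq_div {G : Type*} [CommGroup G] {I : Type*} (ord : I → G → ℚ)
    (hsep : ∀ x y, (∀ i, ord i x = ord i y) → x = y) (hadd : ∀ i x y, ord i (x * y) = ord i x + ord i y)
    (S : I → Prop) {Z Z' W W' : G}
    (hZ : ∀ i, ¬ S i → ord i Z = 0) (hZ' : ∀ i, ¬ S i → ord i Z' = 0)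
    (hW : ∀ i, S i → ord i W = 0) (hW' : ∀ i, S i → ord i W' = 0)
    (h : Z * W⁻¹ = Z' * W'⁻¹) : Z = Z' ∧ W = W' := by
  rw [← div_eq_mul_inv, ← div_eq_mul_inv, div_eq_div_iff_mul_eq_mul] at h
  have hord : ∀ i, ord i Z + ord i W' = ord i Z' + ord i W := fun i => by rw [← hadd, ← hadd, h]
  have hZZ : Z = Z' := hsep Z Z' fun i => by
    by_cases hi : S i
    · have := hord i
      rw [hW i hi, hW' i hi] at this
      simpa using this
    · rw [hZ i hi, hZ' i hi]
  refine ⟨hZZ, hsep W W' fun i => ?_⟩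
  by_cases hi : S i
  · rw [hW i hi, hW' i hi]
  · have := hord i
    rw [hZ i hi, hZ' i hi] at this
    simpa using this.symm

/-- **The split of an equality of transported divisors, generic**: if two group endomorphisms `f, g` of `G` agree on
`Z·W⁻¹`, and `f Z, g Z` are supported on `S` while `f W, g W` are supported off `S` (e.g. `f, g` induced by
cuspidality-preserving monoid automorphisms), then `f Z = g Z` and `f W = g W`.
[cite: MochizukiEtTh2009, Prop 5.3 (vi) p.326 (PDF p.100); Thm 5.6 proof p.329 (PDF p.103)] -/
theorem map_eq_map_split {G : Type*} [CommGroup G] {I : Type*} (ord : I → G → ℚ)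
    (hsep : ∀ x y, (∀ i, ord i x = ord i y) → x = y) (hadd : ∀ i x y, ord i (x * y) = ord i x + ord i y)
    (S : I → Prop) (f g : G →* G) {Z W : G}
    (hfZ : ∀ i, ¬ S i → ord i (f Z) = 0) (hgZ : ∀ i, ¬ S i → ord i (g Z) = 0)
    (hfW : ∀ i, S i → ord i (f W) = 0) (hgW : ∀ i, S i → ord i (g W) = 0)
    (h : f (Z * W⁻¹) = g (Z * W⁻¹)) : f Z = g Z ∧ f W = g W := by
  rw [map_mul, map_inv, map_mul, map_inv] at h
  exact eq_and_eq_of_div_eq_div ord hsep hadd S hfZ hgZ hfW hgW h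

end Literature.AnabelianGeometry.EtaleTheta.FrobenioidThetaDivisors.ZeroPoleSplit
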